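import Literature.AlgebraicGeometry.HodgeTheory.NodalPencilShellFields
import Literature.AlgebraicGeometry.Motives.UniversalHypersurfaceRegularLocusChartFunction
import Literature.AlgebraicGeometry.Motives.UniversalHypersurfaceRegularLocusChartCoeff
import HarnessLib

/-!
# The saturated Morse radius, the pencil coordinate and the pencil slice on `𝒴°(ℂ)` for a monomial pencil near a node

Family `hodge`, layer `Literature/AlgebraicGeometry/HodgeTheory`. Written by the prover seat `hodge-nonav-prover-Bx` (g15, cell
`hodge-nonav`) as a brick of the ODP-ISOTOPY port (memo `PROGRAMME-ODP-ISOTOPY-Bx-g13` §2; Picard–Lefschetz binder hPL₁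
`picardLefschetz_oneNode` of crux K1-B, stmt-HodgeConjecture-19716): the generalisation of prover-Ax's
`CyclicCoverPencilSaturatedRadius`, of the point-set half of `CyclicCoverPencilShellInvariance` and of the slice half of
`CyclicCoverPencilSlice` (steps A2c(ii)–(iii), A3c for the quaternary cyclic pencil `x₃^p = f₁ + c·x₂^p`) to an ARBITRARY degree `d`,
`n + 2` variables, chart `xᵢ ≠ 0` and the monomial pencil direction `xᵢ^d`, with the node read through a Morse chart `Θ` of `ℂⁿ⁺¹`
in which the solved coefficient of `xᵢ^d` is `c₀ + Σⱼ (Θ y)ⱼ²` (`NodalPencilJointSubmersion`, `NodalPencilShellFields`). The PENCIL is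
encoded by ONE coefficient vector `b₀ : DegIndex n d → ℂ` — that of its nodal member: remaining coefficients `b'₀ = (b₀ m)_{m ≠ xᵢ^d}`,
critical value `c₀ = (b₀)_{xᵢ^d}`; the member with pencil coordinate `c` has coefficients `b₀ + c·e_{xᵢ^d}`.

* §1 `satRadius n d i Θ R''' R''` — the SATURATED MORSE RADIUS `F = R'' − regChartExtend n d i (ChartRadius.defect Θ R''' R'' ∘ y)`:
  `C^∞` on `𝒴°(ℂ)` (`contMDiff_satRadius`, `continuous_satRadius`), `= R''` off the chart, `= Σⱼ|Θ y(Q)|ⱼ²` where this is `≤ R'''`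
  (`satRadius_eq_of_le`), its values `< R'''` detect the inner Morse region (`mem_of_satRadius_lt`), it agrees as a germ with the
  cut-off radius `ρ̃ = regChartExtend n d i (ChartRadius.cutoff Θ R''' R'' ∘ y)` there (`satRadius_eventuallyEq_cutoffRadius`,
  `mfderiv_satRadius_eq`), `satRadius_nonneg`;
* §2 `pencilCoord n d i b₀ Q = b_{xᵢ^d}(Q) − (b₀)_{xᵢ^d}`, `pencilSlice n d i b₀ = {b'(Q) = b'₀}` (closed), `continuous_regCoeff`,
  `continuous_pencilCoord`, `regCoeff_eq_add_single_pencilCoord` (`b(Q) = b₀ + c(Q)·e_{xᵢ^d}` on the slice),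
  `norm_regCoeff_sub_eq` (`‖b(Q) − b₀‖ = |c(Q)|` on the slice), `pencilCoord_eq_phi` (`c(Q) = φ(y(Q))` on the chart);
* §3 `mem_shellSet_of_satRadius` — slab points of the slice (`s₀² ≤ F ≤ r₂²`, `r₂² < R'''`, `|c| ≤ δ`) lie in the shell set `K` of
  `NodalPencilShellFields`; `mfderiv_satRadius_smul_eq_zero` — hence `dF(f • X) = 0` there for a field `X` with `dρ̃(X) = 0` on `K`;
  `invariantSet n d i b₀ Θ R''' R'' s₁ = pencilSlice ∩ {s₁² < F}`, `mem_invariantSet_iff`.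

Everything is proved; the four definitions are concrete; no named facts. Honest scope: plumbing of the classical construction of the
geometric monodromy of a pencil near an ordinary double point; nothing here says HC or any rung is proved.

## References

* [ArnoldGuseinzadeVarchenko2012] V. I. Arnold, S. M. Gusein-Zade, A. N. Varchenko, Singularities of Differentiable Maps II (2012),
  Part I §1.1, §2.1.
* [BrockerJanichIDT1982] T. Bröcker, K. Jänich, Introduction to Differential Topology (1982), §7, (8.12).
* [VoisinHodgeII2003] C. Voisin, Hodge Theory and Complex Algebraic Geometry II (2003), §2.3 (Lefschetz pencils), §6.2.1.
-/

noncomputable section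

open CategoryTheory AlgebraicGeometry MvPolynomial TopologicalSpace Set Topology Filter
open scoped Manifold ContDiff LinearAlgebra.Projectivization
open Literature.AlgebraicGeometry.Motives Literature.AlgebraicGeometry.Motives.UniversalHypersurface
open Literature.AlgebraicGeometry.HodgeTheory.UniversalHypersurface Literature.Geometry.ComplexAnalytic
open Literature.NumberTheory.Transcendental

namespace Literature.AlgebraicGeometry.HodgeTheory

namespace NodalPencil

variable (n d : ℕ) (i : Fin (n + 2)) (Θ : OpenPartialHomeomorph (Fin (n + 1) → ℂ) (Fin (n + 1) → ℂ)) (R''' R'' : ℝ)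

/-! ### §1 The saturated Morse radius -/

/-- **The saturated Morse radius** `F(Q) = R'' − regChartExtend n d i (ChartRadius.defect Θ R''' R'' ∘ y) Q`.
[cite: ArnoldGuseinzadeVarchenko2012, Part I §2.1] -/
def satRadius (Q : ComplexPoints (regularTotal ℂ n d)) : ℝ :=
  R'' - regChartExtend n d i (fun v => ChartRadius.defect Θ R''' R'' (fun j => v (Sum.inr j))) Q

/-- Off the chart domain `F = R''`. [cite: ArnoldGuseinzadeVarchenko2012, Part I §2.1] -/
theorem satRadius_of_not_mem {Q : ComplexPoints (regularTotal ℂ n d)} (hQ : Q ∉ regChartDom n d i) :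
    satRadius n d i Θ R''' R'' Q = R'' := by
  rw [satRadius, regChartExtend_of_not_mem n d i _ hQ, sub_zero]

/-- On the chart domain `F = R'' − κ(y(Q))`. [cite: ArnoldGuseinzadeVarchenko2012, Part I §2.1] -/
theorem satRadius_of_mem {Q : ComplexPoints (regularTotal ℂ n d)} (hQ : Q ∈ regChartDom n d i) :
    satRadius n d i Θ R''' R'' Q =
      R'' - ChartRadius.defect Θ R''' R'' (fun j => regChartFun n d i Q (Sum.inr j)) := by
  rw [satRadius, regChartExtend_of_mem n d i _ hQ]

/-- **`F` is `C^∞` on `𝒴°(ℂ)`** (`d ≥ 1`, `Θ` smooth on its source, `R''' < R''`, `{Σ|z|² ≤ R''} ⊆ Θ.target`).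
[cite: BrockerJanichIDT1982, §7] -/
theorem contMDiff_satRadius (hd : 0 < d) (hΘ : ContDiffOn ℝ ∞ Θ Θ.source) (hR : R''' < R'')
    (hR'' : {z : Fin (n + 1) → ℂ | ∑ j, ‖z j‖ ^ 2 ≤ R''} ⊆ Θ.target) :
    haveI := locallyOfFiniteType_regularTotal_hom ℂ n d hd
    haveI := smoothOfRelativeDimension_regularTotal_hom ℂ n d hd
    letI := ComplexPoints.chartedSpace (regularTotal ℂ n d) (n + Fintype.card (DegIndex n d))
    ContMDiff (𝓡 (2 * (n + Fintype.card (DegIndex n d)))) 𝓘(ℝ, ℝ) ∞ (satRadius n d i Θ R''' R'') := by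
  haveI := locallyOfFiniteType_regularTotal_hom ℂ n d hd
  haveI := smoothOfRelativeDimension_regularTotal_hom ℂ n d hd
  letI := ComplexPoints.chartedSpace (regularTotal ℂ n d) (n + Fintype.card (DegIndex n d))
  have hlin : ContDiff ℝ ∞ (fun v : ChartIdx n d i → ℂ => (fun j : Fin (n + 1) => v (Sum.inr j))) :=
    contDiff_pi.2 fun j => contDiff_apply ℝ ℂ (Sum.inr j : ChartIdx n d i)
  have hB : ContDiff ℝ ∞ (fun v : ChartIdx n d i → ℂ => ChartRadius.defect Θ R''' R'' (fun j => v (Sum.inr j))) :=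
    (ChartRadius.contDiff_defect Θ R''' R'' hΘ hR hR'').comp hlin
  obtain ⟨R, hRb⟩ := ChartRadius.exists_bound_defect Θ R''' R'' hR hR''
  have hBR : ∀ v : ChartIdx n d i → ℂ, R < ‖fun j => v (Sum.inr j)‖ →
      ChartRadius.defect Θ R''' R'' (fun j => v (Sum.inr j)) = 0 := fun v hv => hRb _ hv
  exact contMDiff_const.sub (contMDiff_regChartExtend_real n d i hd _ hB hBR)

/-- **`F` is continuous.** [cite: BrockerJanichIDT1982, §7] -/
theorem continuous_satRadius (hd : 0 < d) (hΘ : ContDiffOn ℝ ∞ Θ Θ.source) (hR : R''' < R'')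
    (hR'' : {z : Fin (n + 1) → ℂ | ∑ j, ‖z j‖ ^ 2 ≤ R''} ⊆ Θ.target) :
    Continuous (satRadius n d i Θ R''' R'') := by
  haveI := locallyOfFiniteType_regularTotal_hom ℂ n d hd
  haveI := smoothOfRelativeDimension_regularTotal_hom ℂ n d hd
  letI := ComplexPoints.chartedSpace (regularTotal ℂ n d) (n + Fintype.card (DegIndex n d))
  haveI := ComplexPoints.isManifold_real (regularTotal ℂ n d) (n + Fintype.card (DegIndex n d))
  exact (contMDiff_satRadius n d i Θ R''' R'' hd hΘ hR hR'').continuous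

/-- **Small values of `F` detect the inner Morse region**: `F(Q) < R'''` (`R''' < R''`) implies `Q ∈ 𝒴°(ℂ)ᵢ`, `y(Q) ∈ Θ.source`
and `Σ|Θ(y(Q))|² = F(Q)`. [cite: ArnoldGuseinzadeVarchenko2012, Part I §2.1] -/
theorem mem_of_satRadius_lt (hR : R''' < R'') {Q : ComplexPoints (regularTotal ℂ n d)}
    (hlt : satRadius n d i Θ R''' R'' Q < R''') :
    Q ∈ regChartDom n d i ∧ (fun j => regChartFun n d i Q (Sum.inr j)) ∈ Θ.source ∧
      ∑ j, ‖Θ (fun j => regChartFun n d i Q (Sum.inr j)) j‖ ^ 2 = satRadius n d i Θ R''' R'' Q := by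
  have hQ : Q ∈ regChartDom n d i := by
    by_contra h
    rw [satRadius_of_not_mem n d i Θ R''' R'' h] at hlt
    exact absurd hlt (not_lt.mpr hR.le)
  rw [satRadius_of_mem n d i Θ R''' R'' hQ] at hlt ⊢
  exact ⟨hQ, ChartRadius.lt_of_sub_defect_lt Θ R''' R'' hR hlt⟩

/-- **On the inner region `F` is the Morse radius**: `Q ∈ 𝒴°(ℂ)ᵢ`, `y(Q) ∈ Θ.source`, `Σ|Θ y(Q)|² ≤ R'''` ⇒ `F(Q) = Σ|Θ y(Q)|²`.
[cite: ArnoldGuseinzadeVarchenko2012, Part I §2.1] -/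
theorem satRadius_eq_of_le (hR : R''' < R'') {Q : ComplexPoints (regularTotal ℂ n d)} (hQ : Q ∈ regChartDom n d i)
    (hy : (fun j => regChartFun n d i Q (Sum.inr j)) ∈ Θ.source)
    (hle : ∑ j, ‖Θ (fun j => regChartFun n d i Q (Sum.inr j)) j‖ ^ 2 ≤ R''') :
    satRadius n d i Θ R''' R'' Q = ∑ j, ‖Θ (fun j => regChartFun n d i Q (Sum.inr j)) j‖ ^ 2 := by
  rw [satRadius_of_mem n d i Θ R''' R'' hQ, ChartRadius.defect_of_le Θ R''' R'' hR hy hle]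
  ring

/-- **`F ≥ 0`** when `R'' ≥ 0` (`F ≥ min R'' (Σ|Θ y|²)` on the source, `= R''` elsewhere).
[cite: ArnoldGuseinzadeVarchenko2012, Part I §2.1] -/
theorem satRadius_nonneg (hR : R''' < R'') (h0 : 0 ≤ R'') (Q : ComplexPoints (regularTotal ℂ n d)) :
    0 ≤ satRadius n d i Θ R''' R'' Q := by
  by_cases hQ : Q ∈ regChartDom n d i
  · rw [satRadius_of_mem n d i Θ R''' R'' hQ]
    by_cases hy : (fun j => regChartFun n d i Q (Sum.inr j)) ∈ Θ.source
    · refine le_trans (le_min h0 ?_) (ChartRadius.min_le_sub_defect Θ R''' R'' hR hy)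
      exact Finset.sum_nonneg fun j _ => by positivity
    · rw [ChartRadius.defect_of_not_mem Θ R''' R'' hy, sub_zero]; exact h0
  · rw [satRadius_of_not_mem n d i Θ R''' R'' hQ]; exact h0

/-- **Near the inner region `F` agrees with the cut-off radius `ρ̃`** (both are the Morse radius there): at `Q ∈ 𝒴°(ℂ)ᵢ` with
`y(Q) ∈ Θ.source`, `Σ|Θ y(Q)|² < R'''` (`d ≥ 1`, `R''' < R''`),
`F =ᶠ[𝓝 Q] regChartExtend n d i (ChartRadius.cutoff Θ R''' R'' ∘ y)`. [cite: ArnoldGuseinzadeVarchenko2012, Part I §2.1] -/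
theorem satRadius_eventuallyEq_cutoffRadius (hd : 0 < d) (hR : R''' < R'') {Q : ComplexPoints (regularTotal ℂ n d)}
    (hQ : Q ∈ regChartDom n d i) (hy : (fun j => regChartFun n d i Q (Sum.inr j)) ∈ Θ.source)
    (hlt : ∑ j, ‖Θ (fun j => regChartFun n d i Q (Sum.inr j)) j‖ ^ 2 < R''') :
    haveI := locallyOfFiniteType_regularTotal_hom ℂ n d hd
    haveI := smoothOfRelativeDimension_regularTotal_hom ℂ n d hd
    letI := ComplexPoints.chartedSpace (regularTotal ℂ n d) (n + Fintype.card (DegIndex n d))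
    satRadius n d i Θ R''' R'' =ᶠ[𝓝 Q]
      regChartExtend n d i (fun v => ChartRadius.cutoff Θ R''' R'' (fun j => v (Sum.inr j))) := by
  haveI := locallyOfFiniteType_regularTotal_hom ℂ n d hd
  haveI := smoothOfRelativeDimension_regularTotal_hom ℂ n d hd
  letI := ComplexPoints.chartedSpace (regularTotal ℂ n d) (n + Fintype.card (DegIndex n d))
  have hyc : ContinuousAt (fun Q' : ComplexPoints (regularTotal ℂ n d) => fun j => regChartFun n d i Q' (Sum.inr j)) Q := by
    have h1 : ContinuousAt (regChartFun n d i) Q := (contMDiffAt_regChartFun n d i hd hQ).continuousAt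
    exact (continuous_pi fun j => continuous_apply (Sum.inr j)).continuousAt.comp h1
  have hev1 := ChartRadius.sub_defect_eventuallyEq Θ R''' R'' hR hy hlt
  have hev2 := ChartRadius.cutoff_eventuallyEq Θ R''' R'' hR hy hlt
  have hev : (fun y => R'' - ChartRadius.defect Θ R''' R'' y) =ᶠ[𝓝 (fun j => regChartFun n d i Q (Sum.inr j))]
      ChartRadius.cutoff Θ R''' R'' := hev1.trans hev2.symm
  have hpull := hev.comp_tendsto hyc
  filter_upwards [hpull, (isOpen_regChartDom n d i).mem_nhds hQ] with Q' hQ' hQ'dom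
  rw [satRadius_of_mem n d i Θ R''' R'' hQ'dom, regChartExtend_of_mem n d i _ hQ'dom]
  exact hQ'

/-- **Hence `F` and `ρ̃` have the same differential near the inner region.** [cite: ArnoldGuseinzadeVarchenko2012, Part I §2.1] -/
theorem mfderiv_satRadius_eq (hd : 0 < d) (hR : R''' < R'') {Q : ComplexPoints (regularTotal ℂ n d)}
    (hQ : Q ∈ regChartDom n d i) (hy : (fun j => regChartFun n d i Q (Sum.inr j)) ∈ Θ.source)
    (hlt : ∑ j, ‖Θ (fun j => regChartFun n d i Q (Sum.inr j)) j‖ ^ 2 < R''') :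
    haveI := locallyOfFiniteType_regularTotal_hom ℂ n d hd
    haveI := smoothOfRelativeDimension_regularTotal_hom ℂ n d hd
    letI := ComplexPoints.chartedSpace (regularTotal ℂ n d) (n + Fintype.card (DegIndex n d))
    mfderiv (𝓡 (2 * (n + Fintype.card (DegIndex n d)))) 𝓘(ℝ, ℝ) (satRadius n d i Θ R''' R'') Q =
      mfderiv (𝓡 (2 * (n + Fintype.card (DegIndex n d)))) 𝓘(ℝ, ℝ)
        (regChartExtend n d i (fun v => ChartRadius.cutoff Θ R''' R'' (fun j => v (Sum.inr j)))) Q := by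
  haveI := locallyOfFiniteType_regularTotal_hom ℂ n d hd
  haveI := smoothOfRelativeDimension_regularTotal_hom ℂ n d hd
  letI := ComplexPoints.chartedSpace (regularTotal ℂ n d) (n + Fintype.card (DegIndex n d))
  exact (satRadius_eventuallyEq_cutoffRadius n d i Θ R''' R'' hd hR hQ hy hlt).mfderiv_eq

/-! ### §2 The pencil coordinate and the pencil slice -/

variable (b₀ : DegIndex n d → ℂ)

/-- **The pencil coordinate** `c(Q) = b_{xᵢ^d}(Q) − (b₀)_{xᵢ^d}` of the pencil whose nodal member has coefficient vector `b₀`.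
[cite: VoisinHodgeII2003, §2.3] -/
def pencilCoord (Q : ComplexPoints (regularTotal ℂ n d)) : ℂ :=
  regCoeff ℂ n d Q (regPowIndex n d i) - b₀ (regPowIndex n d i)

/-- **The pencil slice** `S = {Q ∈ 𝒴°(ℂ) | b_m(Q) = (b₀)_m for all m ≠ xᵢ^d}` (the members of the pencil `b₀ + c·e_{xᵢ^d}` inside
the regular locus). [cite: VoisinHodgeII2003, §2.3] -/
def pencilSlice : Set (ComplexPoints (regularTotal ℂ n d)) :=
  {Q | ∀ m : {m : DegIndex n d // m ≠ regPowIndex n d i}, regCoeff ℂ n d Q m.1 = b₀ m.1}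

/-- Membership in the slice, unfolded. [cite: VoisinHodgeII2003, §2.3] -/
theorem mem_pencilSlice_iff (Q : ComplexPoints (regularTotal ℂ n d)) :
    Q ∈ pencilSlice n d i b₀ ↔ ∀ m : {m : DegIndex n d // m ≠ regPowIndex n d i}, regCoeff ℂ n d Q m.1 = b₀ m.1 :=
  Iff.rfl

/-- **The coefficient map `Q ↦ b(Q)` is continuous on `𝒴°(ℂ)`** (`d ≥ 1`; it is `C^∞`, `contMDiffAt_regCoeff`).
[cite: VoisinHodgeII2003, §6.2.1] -/
theorem continuous_regCoeff (hd : 0 < d) : Continuous fun Q : ComplexPoints (regularTotal ℂ n d) => regCoeff ℂ n d Q := by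
  haveI := locallyOfFiniteType_regularTotal_hom ℂ n d hd
  haveI := smoothOfRelativeDimension_regularTotal_hom ℂ n d hd
  letI := ComplexPoints.chartedSpace (regularTotal ℂ n d) (n + Fintype.card (DegIndex n d))
  haveI := ComplexPoints.isManifold_real (regularTotal ℂ n d) (n + Fintype.card (DegIndex n d))
  exact continuous_iff_continuousAt.mpr fun Q => (contMDiffAt_regCoeff n d hd Q).continuousAt

/-- **The pencil coordinate is continuous on `𝒴°(ℂ)`** (`d ≥ 1`). [cite: VoisinHodgeII2003, §6.2.1] -/
theorem continuous_pencilCoord (hd : 0 < d) : Continuous (pencilCoord n d i b₀) :=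
  ((continuous_apply (regPowIndex n d i)).comp (continuous_regCoeff n d hd)).sub continuous_const

/-- **The slice is closed** (a level set of finitely many continuous coefficient functions, `d ≥ 1`). [cite: VoisinHodgeII2003, §2.3] -/
theorem isClosed_pencilSlice (hd : 0 < d) : IsClosed (pencilSlice n d i b₀) := by
  have h : pencilSlice n d i b₀ = ⋂ m : {m : DegIndex n d // m ≠ regPowIndex n d i}, {Q | regCoeff ℂ n d Q m.1 = b₀ m.1} := by
    ext Q; simp [pencilSlice]
  rw [h]
  exact isClosed_iInter fun m => isClosed_eq ((continuous_apply m.1).comp (continuous_regCoeff n d hd)) continuous_const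

/-- **On the slice the coefficient vector is `b₀ + c(Q)·e_{xᵢ^d}`.** [cite: VoisinHodgeII2003, §2.3] -/
theorem regCoeff_eq_add_single_pencilCoord {Q : ComplexPoints (regularTotal ℂ n d)} (hQ : Q ∈ pencilSlice n d i b₀) :
    regCoeff ℂ n d Q = b₀ + Pi.single (regPowIndex n d i) (pencilCoord n d i b₀ Q) := by
  funext m
  by_cases hm : m = regPowIndex n d i
  · subst hm
    rw [Pi.add_apply, Pi.single_eq_same, pencilCoord]
    ring
  · rw [Pi.add_apply, Pi.single_eq_of_ne hm, add_zero]
    exact hQ ⟨m, hm⟩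

/-- **On the slice `‖b(Q) − b₀‖ = |c(Q)|`** (sup norm). [cite: BrockerJanichIDT1982, (8.12)] -/
theorem norm_regCoeff_sub_eq {Q : ComplexPoints (regularTotal ℂ n d)} (hQ : Q ∈ pencilSlice n d i b₀) :
    ‖regCoeff ℂ n d Q - b₀‖ = ‖pencilCoord n d i b₀ Q‖ := by
  rw [regCoeff_eq_add_single_pencilCoord n d i b₀ hQ, add_sub_cancel_left, Pi.norm_single]

/-- **On the chart `xᵢ ≠ 0` the pencil coordinate of a slice point is `φ(y(Q))`**, for any `φ` with
`φ(y) = (solved coefficient of xᵢ^d at (b'₀, y)) − (b₀)_{xᵢ^d}`. [cite: VoisinHodgeII2003, §2.3 and §6.2.1] -/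
theorem pencilCoord_eq_phi (φ : (Fin (n + 1) → ℂ) → ℂ)
    (hφ : ∀ y, φ y = regChartCoeffVec n d i
      (Sum.elim (fun m : {m : DegIndex n d // m ≠ regPowIndex n d i} => b₀ m.1) y) (regPowIndex n d i) - b₀ (regPowIndex n d i))
    {Q : ComplexPoints (regularTotal ℂ n d)} (hQd : Q ∈ regChartDom n d i) (hQ : Q ∈ pencilSlice n d i b₀) :
    pencilCoord n d i b₀ Q = φ (fun j => regChartFun n d i Q (Sum.inr j)) := by
  have hv : regChartFun n d i Q =
      Sum.elim (fun m : {m : DegIndex n d // m ≠ regPowIndex n d i} => b₀ m.1) (fun j => regChartFun n d i Q (Sum.inr j)) := by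
    funext s
    rcases s with m | j
    · exact hQ m
    · rfl
  have h := congrFun (regCoeff_eq_regChartCoeffVec n d i hQd) (regPowIndex n d i)
  rw [hv] at h
  rw [pencilCoord, h, hφ]

/-! ### §3 Slab points of the slice lie in the shell set; `F` is a first integral there; the invariant set -/

variable (s₀ r₂ δ : ℝ)

/-- **Slab points of the slice with small pencil coordinate lie in the shell set**: if `Q ∈ S`, `s₀² ≤ F(Q) ≤ r₂²` with
`r₂² < R''' < R''`, and `|c(Q)| ≤ δ`, then `Q ∈ shellSet Θ φ s₀ r₂ δ d i b'₀` (`φ` as in `pencilCoord_eq_phi`).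
[cite: ArnoldGuseinzadeVarchenko2012, Part I §2.1] -/
theorem mem_shellSet_of_satRadius (hR : R''' < R'') (hr : r₂ ^ 2 < R''') (φ : (Fin (n + 1) → ℂ) → ℂ)
    (hφ : ∀ y, φ y = regChartCoeffVec n d i
      (Sum.elim (fun m : {m : DegIndex n d // m ≠ regPowIndex n d i} => b₀ m.1) y) (regPowIndex n d i) - b₀ (regPowIndex n d i))
    {Q : ComplexPoints (regularTotal ℂ n d)} (hQ : Q ∈ pencilSlice n d i b₀)
    (hlow : s₀ ^ 2 ≤ satRadius n d i Θ R''' R'' Q) (hup : satRadius n d i Θ R''' R'' Q ≤ r₂ ^ 2)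
    (hc : ‖pencilCoord n d i b₀ Q‖ ≤ δ) :
    Q ∈ shellSet Θ φ s₀ r₂ δ d i (fun m : {m : DegIndex n d // m ≠ regPowIndex n d i} => b₀ m.1) := by
  obtain ⟨hQd, hy, hSig⟩ := mem_of_satRadius_lt n d i Θ R''' R'' hR (lt_of_le_of_lt hup hr)
  set y : Fin (n + 1) → ℂ := fun j => regChartFun n d i Q (Sum.inr j) with hydef
  refine ⟨?_, fun m => hQ m⟩
  have hyC : y ∈ affineShell Θ φ s₀ r₂ δ := by
    refine ⟨⟨Θ y, ⟨Θ.map_source hy, ?_, ?_⟩, Θ.left_inv hy⟩, ?_⟩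
    · rw [hSig]; exact hlow
    · rw [hSig]; exact hup
    · change ‖φ y‖ ≤ δ
      rw [hydef, ← pencilCoord_eq_phi n d i b₀ φ hφ hQd hQ]; exact hc
  refine ⟨y, hyC, ?_⟩
  have hsrc : hypersurfacePoint (regularToProjectiveSpace ℂ n d) Q ∈ Projectivization.stdChartSource (𝕜 := ℂ) i := by
    have := hQd; rw [regChartDom_eq_preimage, Set.mem_preimage, Projectivization.stdChart_source] at this; exact this
  have hyeq : y = Projectivization.stdChartFun i (hypersurfacePoint (regularToProjectiveSpace ℂ n d) Q) := by
    funext j; rfl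
  rw [hyeq, Projectivization.stdChartInv_stdChartFun i hsrc]

-- the tangent space of `ℝ` is `ℝ` by definition
set_option backward.isDefEq.respectTransparency false in
/-- **The saturated radius is a first integral of `f • X` at the slab points of the slice**, for a field `X` with `dρ̃(X) = 0` on the
shell set (`ρ̃ = regChartExtend n d i (ChartRadius.cutoff Θ R''' R'' ∘ y)`) and any scalar `f` (`d ≥ 1`).
[cite: ArnoldGuseinzadeVarchenko2012, Part I §1.1] -/
theorem mfderiv_satRadius_smul_eq_zero (hd : 0 < d) (hR : R''' < R'') (hr : r₂ ^ 2 < R''') (φ : (Fin (n + 1) → ℂ) → ℂ)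
    (hφ : ∀ y, φ y = regChartCoeffVec n d i
      (Sum.elim (fun m : {m : DegIndex n d // m ≠ regPowIndex n d i} => b₀ m.1) y) (regPowIndex n d i) - b₀ (regPowIndex n d i))
    (X' : haveI := locallyOfFiniteType_regularTotal_hom ℂ n d hd
      haveI := smoothOfRelativeDimension_regularTotal_hom ℂ n d hd
      letI := ComplexPoints.chartedSpace (regularTotal ℂ n d) (n + Fintype.card (DegIndex n d))
      Π Q : ComplexPoints (regularTotal ℂ n d), TangentSpace (𝓡 (2 * (n + Fintype.card (DegIndex n d)))) Q)
    (f : ComplexPoints (regularTotal ℂ n d) → ℝ)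
    (hX' : haveI := locallyOfFiniteType_regularTotal_hom ℂ n d hd
      haveI := smoothOfRelativeDimension_regularTotal_hom ℂ n d hd
      letI := ComplexPoints.chartedSpace (regularTotal ℂ n d) (n + Fintype.card (DegIndex n d))
      ∀ Q ∈ shellSet Θ φ s₀ r₂ δ d i (fun m : {m : DegIndex n d // m ≠ regPowIndex n d i} => b₀ m.1),
        mfderiv (𝓡 (2 * (n + Fintype.card (DegIndex n d)))) 𝓘(ℝ, ℝ)
          (regChartExtend n d i (fun v => ChartRadius.cutoff Θ R''' R'' (fun j => v (Sum.inr j)))) Q (X' Q) = 0)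
    {Q : ComplexPoints (regularTotal ℂ n d)} (hQ : Q ∈ pencilSlice n d i b₀)
    (hlow : s₀ ^ 2 ≤ satRadius n d i Θ R''' R'' Q) (hup : satRadius n d i Θ R''' R'' Q ≤ r₂ ^ 2)
    (hc : ‖pencilCoord n d i b₀ Q‖ ≤ δ) :
    haveI := locallyOfFiniteType_regularTotal_hom ℂ n d hd
    haveI := smoothOfRelativeDimension_regularTotal_hom ℂ n d hd
    letI := ComplexPoints.chartedSpace (regularTotal ℂ n d) (n + Fintype.card (DegIndex n d))
    mfderiv (𝓡 (2 * (n + Fintype.card (DegIndex n d)))) 𝓘(ℝ, ℝ) (satRadius n d i Θ R''' R'') Q (f Q • X' Q) = 0 := by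
  haveI := locallyOfFiniteType_regularTotal_hom ℂ n d hd
  haveI := smoothOfRelativeDimension_regularTotal_hom ℂ n d hd
  letI := ComplexPoints.chartedSpace (regularTotal ℂ n d) (n + Fintype.card (DegIndex n d))
  obtain ⟨hQd, hy, hSig⟩ := mem_of_satRadius_lt n d i Θ R''' R'' hR (lt_of_le_of_lt hup hr)
  have hlt : ∑ j, ‖Θ (fun j => regChartFun n d i Q (Sum.inr j)) j‖ ^ 2 < R''' := by rw [hSig]; exact lt_of_le_of_lt hup hr
  have h0 := hX' Q (mem_shellSet_of_satRadius n d i Θ R''' R'' b₀ s₀ r₂ δ hR hr φ hφ hQ hlow hup hc)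
  rw [mfderiv_satRadius_eq n d i Θ R''' R'' hd hR hQd hy hlt, map_smul]
  exact (congrArg (fun t : ℝ => f Q • t) h0).trans (smul_zero _)

variable (s₁ : ℝ)

/-- **The invariant set** `A = S ∩ {s₁² < F}` (the slice outside the Morse ball of radius `s₁`).
[cite: ArnoldGuseinzadeVarchenko2012, Part I §2.1] -/
def invariantSet : Set (ComplexPoints (regularTotal ℂ n d)) :=
  {Q | Q ∈ pencilSlice n d i b₀ ∧ s₁ ^ 2 < satRadius n d i Θ R''' R'' Q}

/-- Membership in the invariant set, unfolded. [cite: ArnoldGuseinzadeVarchenko2012, Part I §2.1] -/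
theorem mem_invariantSet_iff (Q : ComplexPoints (regularTotal ℂ n d)) :
    Q ∈ invariantSet n d i Θ R''' R'' b₀ s₁ ↔ Q ∈ pencilSlice n d i b₀ ∧ s₁ ^ 2 < satRadius n d i Θ R''' R'' Q :=
  Iff.rfl

end NodalPencil

end Literature.AlgebraicGeometry.HodgeTheory

end
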